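import Summits.AtomisticToContinuum.HydrodynamicLimit.Theorems.LambertianContactSwapLambertianEulerFwdGood
import Literature.Analysis.FluidPDE.HardSphereCollisionIntensity
import Literature.MathematicalPhysics.KineticTheory.LambertianRedrawNondegenerate
import HarnessLib

/-!
# Finite collision intensity of the Lambertian hard-sphere flow on energy shells
# (`LambertianContactSwap.LambertianEuler`, stmt-AtomisticToContinuum-11854, line `Sketch`; stub `stub_collisionIntensityLambda`)

The Λ-copy of the deterministic collision-intensity bound `Literature.Analysis.FluidPDE.Alexander.lintegral_collisionCount_shell_le`
(bookkeeping layer `HardSphereWindowCollisionCount`) for the Lambertian hard-sphere flow `Λ_t(z; ξs) = lambertFlow G ε ξs z t` on `𝕋³`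
driven by i.i.d. Gaussian redraws `ξs ~ γ^ℕ = lambertNoise (Fin 3)`: **the expected number `K_t` of Lambertian collisions in `[0, t]` is
finite on every energy shell `E ≤ V²/2` of the hard-sphere domain, at most linear in `t` and polynomial in `V`**:
`∫⁻_{(D ∩ {E ≤ V²/2}) × (ℕ → V3)} K_t d(vol ⊗ γ^ℕ) ≤ N² (3 · 4V · vol B₁) vol(B̄_V)^N · t ≤ C (1 + V)^{3N+1} t`.

Route (GST 2013, proof of Prop. 4.1.1, run for the COUNT along `Λ`). Mesh `δ = t/(m+1)`, interaction length `r = 4Vδ = 2(2V)δ`.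
From a short-time good state, for every noise off the degenerate redraws `headBad`, a window carries at most one collision and none
off the hit pieces (`lambertCount_window`: `LWindow.lambert_window_free` / `lambert_window_hit`); by the restart cocycle of the count
(`LRestart.lambertCount_add_of_segment`), on the survivors `iterGoodL m` of the Lambertian GST iteration (`…LambertianEulerIterateGood`)
whose restarted pairs at the window-starts are off `headBad` — an a.e. condition (`ae_restart_not_mem_headBad`: null noise-sections at
`w = 0`, fresh-tail transfer MARKOV `stub_markovLambda` at `w = k + 1`) — `K_t` is at most the number of window-starts at which some pair
is `r`-close to contact (`lambertCount_le_sum_indicator_of_mem_iterGoodL`, `hitPiece ⊆ closePair`). The survivors do not lose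
`vol ⊗ γ^ℕ`-volume (`measure_iterGoodL_inter_preimage_le`, WINDOW `stub_windowLambda`), an `r`-close pair in the velocity ball costs
`N² (3 r vol B₁) vol(B̄_V)^N` (`volume_iUnion_closePair_inter_velBall_le`), and the non-survivors cost `(m+1) · windowLoss δ (2V) → 0`
(`measure_shell_diff_iterGoodL_le`, `tendsto_windowLoss`) against the truncation level; `m → ∞`, then monotone convergence in the
level (`lintegral_lambertCount_shell_le`). Finally `vol(B̄_V) = V³ vol B₁` (`Measure.addHaar_closedBall`) and `V^{3N+1} ≤ (1+V)^{3N+1}`.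

References: I. Gallagher, L. Saint-Raymond, B. Texier, *From Newton to Boltzmann* (EMS 2013), §4.1, proof of Prop. 4.1.1 p. 19;
C. Cercignani, R. Illner, M. Pulvirenti, *The Mathematical Theory of Dilute Gases* (Springer 1994), §4.2, App. 4.A.
-/

noncomputable section

open scoped BigOperators Topology ENNReal InnerProductSpace
open MeasureTheory ProbabilityTheory Filter Set InformationTheory
open Literature.MathematicalPhysics.KineticTheory
open Literature.Analysis.FluidPDE Literature.Analysis.FluidPDE.Alexander

namespace Summit.AtomisticToContinuum.HydrodynamicLimit.Theorems.LambertianContactSwapLambertianEulerCollisionIntensity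

open LambertianContactSwapLambertianEulerIterateGood LambertianContactSwapLambertianEulerIterate
  LambertianContactSwapLambertianEulerFwdGood LWindow

variable {N : ℕ} {ε r δ V : ℝ}

/-! ## One window from a short-time good datum, off the degenerate redraws -/

/-- On the short-time good set of the shell the first exit time is positive, so the Lambertian flow starts at the datum and no
collision is counted at time `0` (whatever the noise). [folklore] -/
theorem lambertFlow_zero_of_mem_shortGood (hε : 0 < ε) (hV0 : 0 ≤ V) (hδ : 0 ≤ δ) (hr4 : 4 * V * δ ≤ r) (hεr : ε + 2 * r < 2⁻¹)
    {z : Config N (Fin 3) T3} (hz : z ∈ shortGood N ε r δ) (hE : configEnergy z ≤ V ^ 2 / 2) (ξs : ℕ → V3) :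
    lambertFlow (Torus.geometry (Fin 3)) ε ξs z 0 = z ∧ lambertCount (Torus.geometry (Fin 3)) ε ξs z 0 = 0 := by
  have hpos : 0 < freeExitTime (Torus.geometry (Fin 3)) ε z :=
    freeExitTime_pos_of_mem_shortGood hε hεr (by linarith [mul_nonneg hV0 hδ]) hV0 hδ hE hz
  exact ⟨lambertFlow_zero_of_pos hpos, lambertCount_eq_zero_of_lt (by rwa [ENNReal.ofReal_zero])⟩

/-- **At most one Lambertian collision in the window, and none off the hit pieces**: from a short-time good datum of the energy
shell `E ≤ V²/2` (`4Vδ ≤ r`, `ε + 2r < 1/2`), driven by a noise whose first vector is non-degenerate about every pair normal, the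
collision instants pass `δ`, at most one collision is counted in `[0, δ]`, and none unless the datum lies in a hit piece
(`LWindow.lambert_window_hit` on the hit pieces, `LWindow.lambert_window_free` elsewhere). [cite: GST2013, proof of Prop. 4.1.1 p. 19] -/
theorem lambertCount_window (hε : 0 < ε) (hV0 : 0 ≤ V) (hδ : 0 ≤ δ) (hr4 : 4 * V * δ ≤ r) (hεr : ε + 2 * r < 2⁻¹)
    {z : Config N (Fin 3) T3} (hz : z ∈ shortGood N ε r δ) (hE : configEnergy z ≤ V ^ 2 / 2) {ξs : ℕ → V3}
    (hξ : (z, ξs) ∉ headBad N ε) :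
    (∃ k, ENNReal.ofReal δ < lambertInstant (Torus.geometry (Fin 3)) ε ξs z k) ∧ lambertCount (Torus.geometry (Fin 3)) ε ξs z δ ≤ 1 ∧
      ((∀ p : Fin N × Fin N, p.1 < p.2 → z ∉ hitPiece N ε r δ p.1 p.2) → lambertCount (Torus.geometry (Fin 3)) ε ξs z δ = 0) := by
  have hr2 : 2 * V * δ ≤ r := by linarith [mul_nonneg hV0 hδ]
  have hε' : ε < 2⁻¹ := by linarith [mul_nonneg hV0 hδ]
  have hV : ∀ k, ‖(z k).2‖ ≤ V := norm_vel_le_of_configEnergy_le hV0 hE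
  by_cases hhit : ∃ p : Fin N × Fin N, p.1 < p.2 ∧ z ∈ hitPiece N ε r δ p.1 p.2
  · obtain ⟨p, hp, hzp⟩ := hhit
    have hξ' : lambertDir (hitPoint ε ((Torus.geometry (Fin 3)).sepVec (z p.1).1 (z p.2).1, (z p.1).2 - (z p.2).2)) (ξs 0) ≠ 0 :=
      fun h0 => hξ ⟨p.1, p.2, h0⟩
    obtain ⟨-, -, h3, -, h5⟩ := lambert_window_hit (HitHyp.mk hε hεr hr2 hV0 hE hp hzp) hr4 hξ'
    exact ⟨h3, h5.le, fun hnot => (hnot p hp hzp).elim⟩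
  · have H : ∀ t ∈ Icc (0 : ℝ) δ, ∀ k l : Fin N, k ≠ l → ε < ‖(Torus.geometry (Fin 3)).sepVec
        (freeFlight (Torus.geometry (Fin 3)) t z k).1 (freeFlight (Torus.geometry (Fin 3)) t z l).1‖ := by
      rcases mem_shortGood.1 hz with hfar | ⟨p, hp, hno | hzp⟩
      · exact forall_lt_norm_of_mem_farSet hV hr2 hfar
      · exact forall_lt_norm_of_mem_noHitPiece hε hV hr2 hεr hno
      · exact (hhit ⟨p, hp, hzp⟩).elim
    obtain ⟨-, -, h3, -, h5⟩ := lambert_window_free hε' hδ H ξs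
    exact ⟨h3, h5.le.trans zero_le_one, fun _ => h5⟩

/-! ## Counting collisions on the survivors of the iteration -/

/-- **The count of Lambertian collisions on the survivors**: for `q ∈ iterGoodL m` whose restarted pairs `(Λ_{wδ}, unused noise)` at the
window-starts `wδ`, `w ≤ m`, are off the degenerate redraws, and any set `H` containing the hit pieces, the number of collisions in
`[0, (m+1)δ]` is at most the number of window-starts at which the orbit lies in `H` (one window at a time, `lambertCount_window`;
restart cocycle of the count, `LRestart.lambertCount_add_of_segment`). [cite: GST2013, proof of Prop. 4.1.1 p. 19] -/
theorem lambertCount_le_sum_indicator_of_mem_iterGoodL (hε : 0 < ε) (hV0 : 0 ≤ V) (hδ : 0 ≤ δ) (hr4 : 4 * V * δ ≤ r)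
    (hεr : ε + 2 * r < 2⁻¹) {H : Set (Config N (Fin 3) T3)} (hH : ∀ p : Fin N × Fin N, p.1 < p.2 → hitPiece N ε r δ p.1 p.2 ⊆ H)
    (m : ℕ) {q : Config N (Fin 3) T3 × (ℕ → V3)} (hq : q ∈ iterGoodL N ε r δ V m)
    (hhead : ∀ w : ℕ, w ≤ m → (lambertFlow (Torus.geometry (Fin 3)) ε q.2 q.1 ((w : ℝ) * δ),
      fun n => q.2 (n + lambertCount (Torus.geometry (Fin 3)) ε q.2 q.1 ((w : ℝ) * δ))) ∉ headBad N ε) :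
    (lambertCount (Torus.geometry (Fin 3)) ε q.2 q.1 (((m : ℝ) + 1) * δ) : ℝ≥0∞) ≤
      ∑ w ∈ Finset.range (m + 1), H.indicator (fun _ => (1 : ℝ≥0∞)) (lambertFlow (Torus.geometry (Fin 3)) ε q.2 q.1 ((w : ℝ) * δ)) := by
  induction m with
  | zero =>
    obtain ⟨hΛ0, hK0⟩ := lambertFlow_zero_of_mem_shortGood hε hV0 hδ hr4 hεr hq.1 hq.2.1 q.2
    have hh : (q.1, q.2) ∉ headBad N ε := by simpa [hΛ0, hK0] using hhead 0 le_rfl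
    simp only [Nat.cast_zero, zero_add, one_mul, Finset.range_one, Finset.sum_singleton, zero_mul, hΛ0]
    obtain ⟨-, hle1, hzero⟩ := lambertCount_window hε hV0 hδ hr4 hεr hq.1 hq.2.1 hh
    by_cases hhit : ∃ p : Fin N × Fin N, p.1 < p.2 ∧ q.1 ∈ hitPiece N ε r δ p.1 p.2
    · obtain ⟨p, hp, hzp⟩ := hhit
      rw [indicator_of_mem (hH p hp hzp)]
      exact_mod_cast hle1
    · push Not at hhit
      rw [hzero fun p hp => hhit p hp, Nat.cast_zero]
      exact bot_le
  | succ m ih =>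
    have IH := ih (iterGoodL_succ_subset m hq) fun w hw => hhead w (Nat.le_succ_of_le hw)
    set s : ℝ := ((m : ℝ) + 1) * δ with hs_def
    have hs0 : 0 ≤ s := by positivity
    obtain ⟨hy, hS⟩ := hq.2.2 m (Nat.lt_succ_self m)
    have hEy : configEnergy (lambertFlow (Torus.geometry (Fin 3)) ε q.2 q.1 s) ≤ V ^ 2 / 2 := (configEnergy_lambertFlow_le _ _ _).trans hq.2.1
    have hcast : (((m + 1 : ℕ) : ℝ) + 1) * δ = s + δ := by rw [hs_def]; push_cast; ring
    have hcast2 : ((m + 1 : ℕ) : ℝ) * δ = s := by rw [hs_def]; push_cast; ring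
    obtain ⟨k, h1, h2⟩ := LRestart.exists_lambert_segment hS le_rfl
    have hk : lambertCount (Torus.geometry (Fin 3)) ε q.2 q.1 s = k := lambertCount_eq_of_segment h1 h2
    have hh : (lambertFlow (Torus.geometry (Fin 3)) ε q.2 q.1 s, fun n => q.2 (n + k)) ∉ headBad N ε := by
      have h := hhead (m + 1) le_rfl
      rwa [hcast2, hk] at h
    obtain ⟨hj', hle1, hzero⟩ := lambertCount_window hε hV0 hδ hr4 hεr hy hEy hh
    obtain ⟨m', h1', h2'⟩ := LRestart.exists_lambert_segment hj' le_rfl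
    have hm' : lambertCount (Torus.geometry (Fin 3)) ε (fun n => q.2 (n + k)) (lambertFlow (Torus.geometry (Fin 3)) ε q.2 q.1 s) δ = m' :=
      lambertCount_eq_of_segment h1' h2'
    rw [hcast, Finset.sum_range_succ, hcast2, LRestart.lambertCount_add_of_segment hs0 hδ h1 h2 h1' h2']
    by_cases hhit : ∃ p : Fin N × Fin N, p.1 < p.2 ∧ lambertFlow (Torus.geometry (Fin 3)) ε q.2 q.1 s ∈ hitPiece N ε r δ p.1 p.2
    · obtain ⟨p, hp, hyp⟩ := hhit
      rw [indicator_of_mem (hH p hp hyp)]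
      have hm'1 : m' ≤ 1 := hm'.symm.le.trans hle1
      calc ((k + m' : ℕ) : ℝ≥0∞) ≤ (k : ℝ≥0∞) + 1 := by push_cast; exact add_le_add le_rfl (by exact_mod_cast hm'1)
        _ = (lambertCount (Torus.geometry (Fin 3)) ε q.2 q.1 s : ℝ≥0∞) + 1 := by rw [hk]
        _ ≤ _ := add_le_add IH le_rfl
    · push Not at hhit
      rw [hm'.symm.trans (hzero fun p hp => hhit p hp), add_zero, ← hk]
      exact IH.trans le_self_add

/-! ## The degenerate restarts are null; volumes at the window-starts -/

/-- **The survivors of `k + 1` windows restarting into the degenerate redraws are null**: by the fresh-tail transfer on the survivors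
(MARKOV, `stub_markovLambda`) their measure is the integral over the survivors of the null noise-sections of `headBad`. [folklore] -/
theorem measure_iterGoodL_succ_inter_headBad_eq_zero (hε : 0 < ε) (hε' : ε < 2⁻¹) (hδ : 0 ≤ δ) (k : ℕ) :
    (volume.prod (lambertNoise (Fin 3))) (iterGoodL N ε r δ V (k + 1) ∩ {p | (lambertFlow (Torus.geometry (Fin 3)) ε p.2 p.1 (((k : ℝ) + 1) * δ),
      fun n => p.2 (n + lambertCount (Torus.geometry (Fin 3)) ε p.2 p.1 (((k : ℝ) + 1) * δ))) ∈ headBad N ε}) = 0 := by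
  have hM := LambertianContactSwapLambertianEulerMarkov.stub_markovLambda hε hε' (N := N)
  have hG := Torus.isHardSphereRegular_geometry (d := Fin 3) hε'
  have hBad := measurableSet_headBad (N := N) (ε := ε)
  set s : ℝ := ((k : ℝ) + 1) * δ with hs_def
  have hRst : Measurable fun p : Config N (Fin 3) T3 × (ℕ → V3) =>
      (lambertFlow (Torus.geometry (Fin 3)) ε p.2 p.1 s, fun n => p.2 (n + lambertCount (Torus.geometry (Fin 3)) ε p.2 p.1 s)) :=
    (measurable_lambertFlow_torus hε' s).prodMk (measurable_shift (measurable_lambertCount hG Torus.isMeasurable_geometry s) measurable_snd)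
  have hGood := measurableSet_iterGoodL (N := N) (r := r) (δ := δ) (V := V) hε' (k + 1)
  calc (volume.prod (lambertNoise (Fin 3))) (iterGoodL N ε r δ V (k + 1) ∩ {p |
        (lambertFlow (Torus.geometry (Fin 3)) ε p.2 p.1 s, fun n => p.2 (n + lambertCount (Torus.geometry (Fin 3)) ε p.2 p.1 s)) ∈ headBad N ε})
      = ∫⁻ p, (iterGoodL N ε r δ V (k + 1) ∩ {p | (lambertFlow (Torus.geometry (Fin 3)) ε p.2 p.1 s,
          fun n => p.2 (n + lambertCount (Torus.geometry (Fin 3)) ε p.2 p.1 s)) ∈ headBad N ε}).indicator 1 p ∂(volume.prod (lambertNoise (Fin 3))) :=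
        (lintegral_indicator_one (hGood.inter (hRst hBad))).symm
    _ = ∫⁻ p, (iterGoodL N ε r δ V (k + 1)).indicator (fun p => (headBad N ε).indicator (1 : Config N (Fin 3) T3 × (ℕ → V3) → ℝ≥0∞)
          (lambertFlow (Torus.geometry (Fin 3)) ε p.2 p.1 s, fun n => p.2 (n + lambertCount (Torus.geometry (Fin 3)) ε p.2 p.1 s))) p
          ∂(volume.prod (lambertNoise (Fin 3))) := lintegral_congr fun p => indicator_inter_preimage_one _ _ _ p
    _ = ∫⁻ p, (iterGoodL N ε r δ V (k + 1)).indicator (fun p => ∫⁻ ηs, (headBad N ε).indicator (1 : Config N (Fin 3) T3 × (ℕ → V3) → ℝ≥0∞)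
          (lambertFlow (Torus.geometry (Fin 3)) ε p.2 p.1 s, ηs) ∂(lambertNoise (Fin 3))) p ∂(volume.prod (lambertNoise (Fin 3))) :=
        lintegral_iterGoodL_succ_fresh hM hε' hδ k (measurable_one.indicator hBad)
    _ = 0 := by
        refine (lintegral_congr fun p => ?_).trans lintegral_zero
        by_cases hp : p ∈ iterGoodL N ε r δ V (k + 1)
        · rw [Set.indicator_of_mem hp]
          exact lintegral_headBad_section _
        · exact Set.indicator_of_notMem hp _

/-- **Almost every pair restarts off the degenerate redraws at every window-start it survives to** (`wδ`, `w ≤ m`): at `w = 0` the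
restarted pair of a survivor is the pair itself and `headBad` has null noise-sections; at `w = k + 1 ≤ m` the survivors of `m` windows
survive `k + 1` windows (`measure_iterGoodL_succ_inter_headBad_eq_zero`). [folklore] -/
theorem ae_restart_not_mem_headBad (hε : 0 < ε) (hV0 : 0 ≤ V) (hδ : 0 ≤ δ) (hr4 : 4 * V * δ ≤ r) (hεr : ε + 2 * r < 2⁻¹) (m : ℕ) :
    ∀ᵐ q ∂(volume.prod (lambertNoise (Fin 3))), ∀ w : ℕ, w ≤ m → q ∈ iterGoodL N ε r δ V m →
      (lambertFlow (Torus.geometry (Fin 3)) ε q.2 q.1 ((w : ℝ) * δ),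
        fun n => q.2 (n + lambertCount (Torus.geometry (Fin 3)) ε q.2 q.1 ((w : ℝ) * δ))) ∉ headBad N ε := by
  have hε' : ε < 2⁻¹ := by linarith [mul_nonneg hV0 hδ]
  refine ae_all_iff.2 fun w => ?_
  rw [ae_iff]
  cases w with
  | zero =>
    refine measure_mono_null ?_ (Measure.measure_prod_null_of_ae_null (measurableSet_headBad (N := N) (ε := ε))
      (Eventually.of_forall fun z => ?_))
    · intro q hq
      rw [mem_setOf_eq] at hq
      push Not at hq
      obtain ⟨-, hqI, hh⟩ := hq
      obtain ⟨hΛ0, hK0⟩ := lambertFlow_zero_of_mem_shortGood hε hV0 hδ hr4 hεr hqI.1 hqI.2.1 q.2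
      simpa [hΛ0, hK0] using hh
    · show lambertNoise (Fin 3) (Prod.mk z ⁻¹' _) = 0
      exact measure_headBad_section z
  | succ k =>
    refine measure_mono_null ?_ (measure_iterGoodL_succ_inter_headBad_eq_zero (N := N) (r := r) (V := V) hε hε' hδ k)
    intro q hq
    rw [mem_setOf_eq] at hq
    push Not at hq
    obtain ⟨hkm, hqI, hh⟩ := hq
    refine ⟨(antitone_nat_of_succ_le iterGoodL_succ_subset : Antitone (iterGoodL N ε r δ V)) hkm hqI, ?_⟩
    have hcast : ((k + 1 : ℕ) : ℝ) * δ = ((k : ℝ) + 1) * δ := by push_cast; ring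
    rwa [hcast] at hh

/-- **The survivors whose orbit lies in `B` at a window-start have measure at most `vol B`** (`measure_iterGoodL_inter_preimage_le` at
the previous window, fed by WINDOW `stub_windowLambda` and MARKOV `stub_markovLambda`; at `w = 0` the flow is the identity). [folklore] -/
theorem measure_iterGoodL_inter_preimage_windowStart_le (hε : 0 < ε) (hV0 : 0 ≤ V) (hδ : 0 ≤ δ) (hr4 : 4 * V * δ ≤ r)
    (hεr : ε + 2 * r < 2⁻¹) {m w : ℕ} (hw : w ≤ m) {B : Set (Config N (Fin 3) T3)} (hB : MeasurableSet B) :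
    (volume.prod (lambertNoise (Fin 3))) (iterGoodL N ε r δ V m ∩ {p | lambertFlow (Torus.geometry (Fin 3)) ε p.2 p.1 ((w : ℝ) * δ) ∈ B}) ≤
      volume B := by
  have hε' : ε < 2⁻¹ := by linarith [mul_nonneg hV0 hδ]
  cases w with
  | zero =>
    calc (volume.prod (lambertNoise (Fin 3))) (iterGoodL N ε r δ V m ∩ {p | lambertFlow (Torus.geometry (Fin 3)) ε p.2 p.1 (((0 : ℕ) : ℝ) * δ) ∈ B})
        ≤ (volume.prod (lambertNoise (Fin 3))) (B ×ˢ (univ : Set (ℕ → V3))) := by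
          refine measure_mono fun p hp => ⟨?_, mem_univ _⟩
          have h := hp.2
          rwa [mem_setOf_eq, Nat.cast_zero, zero_mul, (lambertFlow_zero_of_mem_shortGood hε hV0 hδ hr4 hεr hp.1.1 hp.1.2.1 p.2).1] at h
      _ = volume B := by rw [Measure.prod_prod, measure_univ, mul_one]
  | succ k =>
    obtain ⟨hW1, hW2⟩ := LambertianContactSwapLambertianEulerWindow.stub_windowLambda hε (N := N) hV0 hδ hr4 hεr
    refine le_trans (measure_mono fun p hp => ?_) (measure_iterGoodL_inter_preimage_le
      (LambertianContactSwapLambertianEulerMarkov.stub_markovLambda hε hε') hW1 hW2 hε' hδ k hB)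
    refine ⟨(antitone_nat_of_succ_le iterGoodL_succ_subset : Antitone (iterGoodL N ε r δ V)) (Nat.le_of_succ_le hw) hp.1, ?_⟩
    have h := hp.2
    have hcast : ((k + 1 : ℕ) : ℝ) * δ = ((k : ℝ) + 1) * δ := by push_cast; ring
    rwa [mem_setOf_eq, hcast] at h

/-! ## The collision intensity bound -/

/-- **The truncated count at mesh `t/(m+1)`** (Λ-copy of `Alexander.lintegral_min_collisionCount_shell_le_of_mesh`, interaction length
`4Vδ = 2(2V)δ`): for `K : ℕ` and `m` with the chart condition,
`∫⁻_{shell × noise} min(K_t, K) ≤ K (m+1) · windowLoss δ (2V) + N² (3 · 4V · vol B₁) vol(B̄_V)^N · t`. [cite: GST2013, proof of Prop. 4.1.1 p. 19] -/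
theorem lintegral_min_lambertCount_shell_le_of_mesh (hε : 0 < ε) (hV0 : 0 ≤ V) {t : ℝ} (ht : 0 ≤ t) (K m : ℕ)
    (hch : ε + 2 * (2 * (2 * V) * (t / ((m : ℝ) + 1))) < 2⁻¹) :
    ∫⁻ p in {z : Config N (Fin 3) T3 | z ∈ hardSphereDomain (Torus.geometry (Fin 3)) N ε ∧ configEnergy z ≤ V ^ 2 / 2} ×ˢ (univ : Set (ℕ → V3)),
        min (lambertCount (Torus.geometry (Fin 3)) ε p.2 p.1 t : ℝ≥0∞) K ∂(volume.prod (lambertNoise (Fin 3))) ≤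
      (K : ℝ≥0∞) * (((m : ℝ≥0∞) + 1) * windowLoss (d := Fin 3) N (t / ((m : ℝ) + 1)) (2 * V)) +
        (N : ℝ≥0∞) ^ 2 * (ENNReal.ofReal (Fintype.card (Fin 3) * (4 * V)) * volume (Metric.ball (0 : V3) 1) *
          volume (Metric.closedBall (0 : V3) V) ^ N) * ENNReal.ofReal t := by
  -- notation
  set δ : ℝ := t / ((m : ℝ) + 1) with hδ_def
  have hm : (0 : ℝ) < (m : ℝ) + 1 := by positivity
  have hδ : 0 ≤ δ := div_nonneg ht hm.le
  have hT : ((m : ℝ) + 1) * δ = t := by rw [hδ_def]; field_simp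
  have hr0 : 0 ≤ 2 * (2 * V) * δ := by positivity
  have hr4 : 4 * V * δ ≤ 2 * (2 * V) * δ := le_of_eq (by ring)
  have hε' : ε < 2⁻¹ := by linarith
  have h12 : ε + 2 * (2 * V) * δ < 1 / 2 := by linarith [(by norm_num : (2⁻¹ : ℝ) = 1 / 2)]
  have h2V0 : 0 ≤ 2 * V := by positivity
  have hVV : V ^ 2 / 2 ≤ (2 * V) ^ 2 / 2 := by nlinarith [sq_nonneg V]
  have hM := LambertianContactSwapLambertianEulerMarkov.stub_markovLambda hε hε' (N := N)
  obtain ⟨hW1, hW2⟩ := LambertianContactSwapLambertianEulerWindow.stub_windowLambda hε (N := N) hV0 hδ hr4 hch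
  set S : Set (Config N (Fin 3) T3) := {z | z ∈ hardSphereDomain (Torus.geometry (Fin 3)) N ε ∧ configEnergy z ≤ V ^ 2 / 2} with hS_def
  have hSUm : MeasurableSet (S ×ˢ (univ : Set (ℕ → V3))) :=
    ((measurableSet_hardSphereDomain _ Torus.measurable_geometry_sepVec N ε).inter (measurableSet_energyShell _)).prod MeasurableSet.univ
  set H : Set (Config N (Fin 3) T3) := ⋃ (p : Fin N × Fin N) (_ : p.1 < p.2), closePair N (Fin 3) ε (2 * (2 * V) * δ) p.1 p.2 with hH_def
  have hHsub : ∀ p : Fin N × Fin N, p.1 < p.2 → hitPiece N ε (2 * (2 * V) * δ) δ p.1 p.2 ⊆ H :=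
    fun p hp z hz => mem_iUnion₂.2 ⟨p, hp, hitPiece_subset_closePair _ _ _ _ _ hz⟩
  set B : Set (Config N (Fin 3) T3) := H ∩ velBall N (Fin 3) T3 V with hB_def
  have hBm : MeasurableSet B := (measurableSet_iUnion_closePair N ε _).inter (measurableSet_velBall V)
  set I : Set (Config N (Fin 3) T3 × (ℕ → V3)) := iterGoodL N ε (2 * (2 * V) * δ) δ V m with hI_def
  have hIm : MeasurableSet I := measurableSet_iterGoodL (N := N) (r := 2 * (2 * V) * δ) (δ := δ) (V := V) hε' m
  set A : ℕ → Set (Config N (Fin 3) T3 × (ℕ → V3)) := fun w =>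
    I ∩ {p | lambertFlow (Torus.geometry (Fin 3)) ε p.2 p.1 ((w : ℝ) * δ) ∈ B} with hA_def
  have hAm : ∀ w, MeasurableSet (A w) := fun w => hIm.inter (measurable_lambertFlow_torus hε' _ hBm)
  -- pointwise bound, almost everywhere on the shell
  have hpt : ∀ᵐ q ∂(volume.prod (lambertNoise (Fin 3))), q ∈ S ×ˢ (univ : Set (ℕ → V3)) →
      min (lambertCount (Torus.geometry (Fin 3)) ε q.2 q.1 t : ℝ≥0∞) K ≤ (K : ℝ≥0∞) * (S ×ˢ (univ : Set (ℕ → V3)) \ I).indicator (fun _ => (1 : ℝ≥0∞)) q +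
        ∑ w ∈ Finset.range (m + 1), (A w).indicator (fun _ => (1 : ℝ≥0∞)) q := by
    filter_upwards [ae_restart_not_mem_headBad (N := N) hε hV0 hδ hr4 hch m] with q hq hqS
    by_cases hqI : q ∈ I
    · have hcount := lambertCount_le_sum_indicator_of_mem_iterGoodL hε hV0 hδ hr4 hch hHsub m hqI fun w hw => hq w hw hqI
      rw [hT] at hcount
      refine (min_le_left _ _).trans (hcount.trans (le_add_left (Finset.sum_le_sum fun w _ => ?_)))
      by_cases hw : lambertFlow (Torus.geometry (Fin 3)) ε q.2 q.1 ((w : ℝ) * δ) ∈ H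
      · have hvel : lambertFlow (Torus.geometry (Fin 3)) ε q.2 q.1 ((w : ℝ) * δ) ∈ velBall N (Fin 3) T3 V :=
          setOf_configEnergy_le_subset_velBall hV0 ((configEnergy_lambertFlow_le _ _ _).trans hqI.2.1)
        rw [indicator_of_mem hw, indicator_of_mem (show q ∈ A w from ⟨hqI, hw, hvel⟩)]
      · rw [indicator_of_notMem hw]
        exact bot_le
    · refine (min_le_right _ _).trans ?_
      rw [indicator_of_mem (show q ∈ S ×ˢ (univ : Set (ℕ → V3)) \ I from ⟨hqS, hqI⟩), mul_one]
      exact le_self_add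
  -- integrate
  have hint : ∫⁻ p in S ×ˢ (univ : Set (ℕ → V3)), min (lambertCount (Torus.geometry (Fin 3)) ε p.2 p.1 t : ℝ≥0∞) K ∂(volume.prod (lambertNoise (Fin 3))) ≤
      (K : ℝ≥0∞) * (volume.prod (lambertNoise (Fin 3))) (S ×ˢ (univ : Set (ℕ → V3)) \ I) +
        ∑ w ∈ Finset.range (m + 1), (volume.prod (lambertNoise (Fin 3))) (A w) := by
    refine (setLIntegral_mono_ae' hSUm hpt).trans ((lintegral_mono' Measure.restrict_le_self le_rfl).trans (le_of_eq ?_))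
    rw [lintegral_add_left (((measurable_const.indicator (hSUm.diff hIm))).const_mul _),
      lintegral_const_mul _ (measurable_const.indicator (hSUm.diff hIm)), lintegral_finsetSum _ fun w _ => measurable_const.indicator (hAm w)]
    congr 1
    · rw [show (fun p => (S ×ˢ (univ : Set (ℕ → V3)) \ I).indicator (fun _ => (1 : ℝ≥0∞)) p) = (S ×ˢ (univ : Set (ℕ → V3)) \ I).indicator 1
        from rfl, lintegral_indicator_one (hSUm.diff hIm)]
    · refine Finset.sum_congr rfl fun w _ => ?_
      rw [show (fun p => (A w).indicator (fun _ => (1 : ℝ≥0∞)) p) = (A w).indicator 1 from rfl, lintegral_indicator_one (hAm w)]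
  -- the two volumes
  have hL : volume {z : Config N (Fin 3) T3 | z ∈ hardSphereDomain (Torus.geometry (Fin 3)) N ε ∧
      configEnergy z ≤ V ^ 2 / 2 ∧ z ∉ shortGood N ε (2 * (2 * V) * δ) δ} ≤ windowLoss (d := Fin 3) N δ (2 * V) := by
    refine le_trans (measure_mono fun z hz => ?_) (volume_shell_diff_shortGood_le hε hch h2V0 hδ)
    exact ⟨hz.1, hz.2.1.trans hVV, hz.2.2⟩
  have hloss : (volume.prod (lambertNoise (Fin 3))) (S ×ˢ (univ : Set (ℕ → V3)) \ I) ≤ ((m : ℝ≥0∞) + 1) * windowLoss (d := Fin 3) N δ (2 * V) :=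
    measure_shell_diff_iterGoodL_le hM hW1 hW2 hε' hδ hL m
  have hB : volume B ≤ (N : ℝ≥0∞) ^ 2 * (ENNReal.ofReal (Fintype.card (Fin 3) * (2 * (2 * V) * δ)) *
      volume (Metric.ball (0 : V3) 1) * volume (Metric.closedBall (0 : V3) V) ^ N) :=
    volume_iUnion_closePair_inter_velBall_le hε hr0 h12 V
  have hAw : ∀ w ∈ Finset.range (m + 1), (volume.prod (lambertNoise (Fin 3))) (A w) ≤ volume B := fun w hw =>
    measure_iterGoodL_inter_preimage_windowStart_le hε hV0 hδ hr4 hch (Nat.lt_succ_iff.1 (Finset.mem_range.1 hw)) hBm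
  have hsum : ∑ w ∈ Finset.range (m + 1), (volume.prod (lambertNoise (Fin 3))) (A w) ≤
      (N : ℝ≥0∞) ^ 2 * (ENNReal.ofReal (Fintype.card (Fin 3) * (4 * V)) * volume (Metric.ball (0 : V3) 1) *
        volume (Metric.closedBall (0 : V3) V) ^ N) * ENNReal.ofReal t := by
    calc ∑ w ∈ Finset.range (m + 1), (volume.prod (lambertNoise (Fin 3))) (A w)
        ≤ ∑ _w ∈ Finset.range (m + 1), volume B := Finset.sum_le_sum hAw
      _ = ((m : ℝ≥0∞) + 1) * volume B := by rw [Finset.sum_const, Finset.card_range, nsmul_eq_mul]; push_cast; ring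
      _ ≤ ((m : ℝ≥0∞) + 1) * ((N : ℝ≥0∞) ^ 2 * (ENNReal.ofReal (Fintype.card (Fin 3) * (2 * (2 * V) * δ)) *
          volume (Metric.ball (0 : V3) 1) * volume (Metric.closedBall (0 : V3) V) ^ N)) := by gcongr
      _ = _ := by
          have h1 : ((m : ℝ≥0∞) + 1) = ENNReal.ofReal ((m : ℝ) + 1) := by
            rw [ENNReal.ofReal_add (by positivity) zero_le_one, ENNReal.ofReal_natCast, ENNReal.ofReal_one]
          have h2 : ENNReal.ofReal (Fintype.card (Fin 3) * (2 * (2 * V) * δ)) = ENNReal.ofReal (Fintype.card (Fin 3) * (4 * V)) * ENNReal.ofReal δ := by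
            rw [← ENNReal.ofReal_mul (by positivity)]; ring_nf
          have h3 : ENNReal.ofReal ((m : ℝ) + 1) * ENNReal.ofReal δ = ENNReal.ofReal t := by rw [← ENNReal.ofReal_mul hm.le, hT]
          rw [h1, h2, ← h3]
          ring
  exact hint.trans (add_le_add (by gcongr) hsum)

/-- **The truncated count**: `∫⁻_{shell × noise} min(K_t, K) ≤ N² (3 · 4V · vol B₁) vol(B̄_V)^N · t` for every `K` (let the mesh go to
zero: `tendsto_windowLoss`, `eventually_chart`). [cite: GST2013, proof of Prop. 4.1.1 p. 19] -/
theorem lintegral_min_lambertCount_shell_le (hε : 0 < ε) (hε' : ε < 2⁻¹) (hV0 : 0 ≤ V) {t : ℝ} (ht : 0 ≤ t) (K : ℕ) :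
    ∫⁻ p in {z : Config N (Fin 3) T3 | z ∈ hardSphereDomain (Torus.geometry (Fin 3)) N ε ∧ configEnergy z ≤ V ^ 2 / 2} ×ˢ (univ : Set (ℕ → V3)),
        min (lambertCount (Torus.geometry (Fin 3)) ε p.2 p.1 t : ℝ≥0∞) K ∂(volume.prod (lambertNoise (Fin 3))) ≤
      (N : ℝ≥0∞) ^ 2 * (ENNReal.ofReal (Fintype.card (Fin 3) * (4 * V)) * volume (Metric.ball (0 : V3) 1) *
        volume (Metric.closedBall (0 : V3) V) ^ N) * ENNReal.ofReal t := by
  set C := (N : ℝ≥0∞) ^ 2 * (ENNReal.ofReal (Fintype.card (Fin 3) * (4 * V)) * volume (Metric.ball (0 : V3) 1) *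
    volume (Metric.closedBall (0 : V3) V) ^ N) * ENNReal.ofReal t with hC
  have hlim : Tendsto (fun m : ℕ => (K : ℝ≥0∞) * (((m : ℝ≥0∞) + 1) * windowLoss (d := Fin 3) N (t / ((m : ℝ) + 1)) (2 * V)) + C) atTop
      (𝓝 ((K : ℝ≥0∞) * 0 + C)) :=
    (ENNReal.Tendsto.const_mul (tendsto_windowLoss (d := Fin 3) (N := N) (by positivity) ht) (Or.inr (ENNReal.natCast_ne_top K))).add
      tendsto_const_nhds
  rw [mul_zero, zero_add] at hlim
  refine ge_of_tendsto hlim ?_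
  filter_upwards [eventually_chart hε' (2 * V) t] with m hm
  exact lintegral_min_lambertCount_shell_le_of_mesh hε hV0 ht K m hm

/-- **Finite collision intensity of the Lambertian flow on energy shells** (Λ-copy of `Alexander.lintegral_collisionCount_shell_le`): for
`0 < ε < 1/2`, `V ≥ 0`, `t ≥ 0`, `∫⁻_{(D ∩ {E ≤ V²/2}) × (ℕ → V3)} K_t d(vol ⊗ γ^ℕ) ≤ N² (3 · 4V · vol B₁) vol(B̄_V)^N · t` (monotone convergence
in the truncation level). [cite: GST2013, proof of Prop. 4.1.1 p. 19] -/
theorem lintegral_lambertCount_shell_le (hε : 0 < ε) (hε' : ε < 2⁻¹) (hV0 : 0 ≤ V) {t : ℝ} (ht : 0 ≤ t) :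
    ∫⁻ p in {z : Config N (Fin 3) T3 | z ∈ hardSphereDomain (Torus.geometry (Fin 3)) N ε ∧ configEnergy z ≤ V ^ 2 / 2} ×ˢ (univ : Set (ℕ → V3)),
        (lambertCount (Torus.geometry (Fin 3)) ε p.2 p.1 t : ℝ≥0∞) ∂(volume.prod (lambertNoise (Fin 3))) ≤
      (N : ℝ≥0∞) ^ 2 * (ENNReal.ofReal (Fintype.card (Fin 3) * (4 * V)) * volume (Metric.ball (0 : V3) 1) *
        volume (Metric.closedBall (0 : V3) V) ^ N) * ENNReal.ofReal t := by
  have hmeas : Measurable fun p : Config N (Fin 3) T3 × (ℕ → V3) => (lambertCount (Torus.geometry (Fin 3)) ε p.2 p.1 t : ℝ≥0∞) :=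
    (measurable_from_nat (f := fun n : ℕ => (n : ℝ≥0∞))).comp
      (measurable_lambertCount (Torus.isHardSphereRegular_geometry (d := Fin 3) hε') Torus.isMeasurable_geometry t)
  have hf : ∀ K : ℕ, Measurable fun p : Config N (Fin 3) T3 × (ℕ → V3) => min (lambertCount (Torus.geometry (Fin 3)) ε p.2 p.1 t : ℝ≥0∞) K :=
    fun K => hmeas.min measurable_const
  have hmono : Monotone fun (K : ℕ) (p : Config N (Fin 3) T3 × (ℕ → V3)) => min (lambertCount (Torus.geometry (Fin 3)) ε p.2 p.1 t : ℝ≥0∞) K :=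
    fun K K' hKK' p => min_le_min_left _ (by exact_mod_cast hKK')
  have hsup : ∀ p : Config N (Fin 3) T3 × (ℕ → V3), (lambertCount (Torus.geometry (Fin 3)) ε p.2 p.1 t : ℝ≥0∞) =
      ⨆ K : ℕ, min (lambertCount (Torus.geometry (Fin 3)) ε p.2 p.1 t : ℝ≥0∞) K := fun p =>
    le_antisymm (le_iSup_of_le (lambertCount (Torus.geometry (Fin 3)) ε p.2 p.1 t) (by simp)) (iSup_le fun K => min_le_left _ _)
  rw [lintegral_congr fun p => hsup p, lintegral_iSup hf hmono]
  exact iSup_le fun K => lintegral_min_lambertCount_shell_le hε hε' hV0 ht K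

/-! ## The registered stub -/

/-- **`stub_collisionIntensityLambda`** (line `Sketch` of the crux `LambertianContactSwap.LambertianEuler`; hard spheres of diameter
`0 < ε < 1/2` on `𝕋³`, Lambertian flow `Λ` driven by `γ^ℕ = lambertNoise`): **finite collision intensity of the Lambertian gas on
energy shells** — there are `C = C(N) < ∞` and `k = 3N + 1` with `∫⁻_{(D ∩ {E ≤ V²/2}) × (ℕ → V3)} K_t d(vol ⊗ γ^ℕ) ≤ C (1 + V)^k t` for all
`V, t ≥ 0` (`lintegral_lambertCount_shell_le` with `C = N² · 12 vol B₁ · (vol B₁)^N`, `vol(B̄_V) = V³ vol B₁` by `Measure.addHaar_closedBall`,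
and `V^{3N+1} ≤ (1+V)^{3N+1}`). [cite: GST2013, proof of Prop. 4.1.1 p. 19] -/
theorem stub_collisionIntensityLambda :
    ∀ {ε : ℝ}, 0 < ε → ε < 2⁻¹ → ∀ N : ℕ, ∃ C : ℝ≥0∞, C < ∞ ∧ ∃ k : ℕ, ∀ (V t : ℝ), 0 ≤ V → 0 ≤ t →
      ∫⁻ p in {z : Config N (Fin 3) T3 | z ∈ hardSphereDomain (Torus.geometry (Fin 3)) N ε ∧
          configEnergy z ≤ V ^ 2 / 2} ×ˢ (Set.univ : Set (ℕ → V3)),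
        (lambertCount (Torus.geometry (Fin 3)) ε p.2 p.1 t : ℝ≥0∞)
          ∂((volume : Measure (Config N (Fin 3) T3)).prod (lambertNoise (Fin 3))) ≤
      C * ENNReal.ofReal ((1 + V) ^ k) * ENNReal.ofReal t := by
  intro ε hε hε' N
  refine ⟨(N : ℝ≥0∞) ^ 2 * (ENNReal.ofReal (Fintype.card (Fin 3) * 4) * volume (Metric.ball (0 : V3) 1) * volume (Metric.ball (0 : V3) 1) ^ N),
    ENNReal.mul_lt_top (ENNReal.pow_lt_top (ENNReal.natCast_lt_top N)) (ENNReal.mul_lt_top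
      (ENNReal.mul_lt_top ENNReal.ofReal_lt_top measure_ball_lt_top) (ENNReal.pow_lt_top measure_ball_lt_top)), 3 * N + 1, ?_⟩
  intro V t hV0 ht
  refine (lintegral_lambertCount_shell_le hε hε' hV0 ht).trans ?_
  have hV1 : ENNReal.ofReal V ≤ ENNReal.ofReal (1 + V) := ENNReal.ofReal_le_ofReal (by linarith)
  rw [Measure.addHaar_closedBall volume _ hV0, finrank_euclideanSpace_fin,
    (by ring : (Fintype.card (Fin 3) : ℝ) * (4 * V) = Fintype.card (Fin 3) * 4 * V), ENNReal.ofReal_mul (by positivity),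
    ENNReal.ofReal_pow hV0, ENNReal.ofReal_pow (by positivity : (0 : ℝ) ≤ 1 + V)]
  calc (N : ℝ≥0∞) ^ 2 * (ENNReal.ofReal (Fintype.card (Fin 3) * 4) * ENNReal.ofReal V * volume (Metric.ball (0 : V3) 1) *
        (ENNReal.ofReal V ^ 3 * volume (Metric.ball (0 : V3) 1)) ^ N) * ENNReal.ofReal t
      ≤ (N : ℝ≥0∞) ^ 2 * (ENNReal.ofReal (Fintype.card (Fin 3) * 4) * ENNReal.ofReal (1 + V) * volume (Metric.ball (0 : V3) 1) *
        (ENNReal.ofReal (1 + V) ^ 3 * volume (Metric.ball (0 : V3) 1)) ^ N) * ENNReal.ofReal t := by gcongr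
    _ = _ := by ring

end Summit.AtomisticToContinuum.HydrodynamicLimit.Theorems.LambertianContactSwapLambertianEulerCollisionIntensity

end
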